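import Mathlib.Analysis.Fourier.AddCircle
import HarnessLib

/-!
# The `L²` tail of the Fourier partial sum of a periodic `C¹` function:
# `‖f − S_N f‖_{L²(a,b)} ≤ (b − a)/(2π(N+1)) · ‖f′‖_{L²(a,b)}`

`Literature/Analysis/Fourier`, sibling of `Wirtinger.lean` (the case "`N = 0`, mean zero").  For
`f : ℝ → ℂ` differentiable with continuous derivative `f′` and `f b = f a` (`a < b`), let
`c_n = fourierCoeffOn f n` be its Fourier coefficients on `[a, b]` (period `T = b − a`,
characters `e_n(x) = fourier n (x : AddCircle T) = exp(2πinx/T)`) and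
`S_N f = ∑_{|n| ≤ N} c_n e_n` its symmetric partial sum of order `N`.  Then

  `∫_a^b ‖f − S_N f‖² ≤ (T/(2π(N+1)))² ∫_a^b ‖f′‖²`      (`intervalIntegral_norm_sub_fourierSum_sq_le`).

PROOF (the printed one): by orthogonality `c_n(S_N f) = c_n` for `|n| ≤ N` and `0` otherwise
(`fourierCoeffOn_fourier_coe` and a private linearity lemma), so Parseval
(`hasSum_sq_fourierCoeffOn`) gives `T⁻¹∫‖f − S_N f‖² = ∑_{|n| > N} |c_n|²`; integration by parts
(`fourierCoeffOn_of_hasDerivAt`, periodicity kills the boundary term) gives `c_n = T c_n(f′)/(2πin)`,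
hence `|c_n|² ≤ (T/(2π(N+1)))² |c_n(f′)|²` for `|n| ≥ N + 1`, and Parseval for `f′` closes.
This is the `m = 1` case, with the sharp constant, of the spectral truncation estimate
`‖u − P_N u‖_{L²(0,2π)} ≤ C N^{-m} ‖u^{(m)}‖_{L²(0,2π)}` of Canuto–Hussaini–Quarteroni–Zang,
*Spectral Methods. Fundamentals in Single Domains* (Springer 2006) [CanutoEtAl2006], §5.1.2,
eq. (5.1.9) ("This follows from the Parseval identity …"); classical.  No definitions, no named facts.

## References
* [CanutoEtAl2006] C. Canuto, M. Y. Hussaini, A. Quarteroni, T. A. Zang, *Spectral Methods.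
  Fundamentals in Single Domains*, Springer 2006, doi:10.1007/978-3-540-30726-6, §2.1.1 (2.1.2)–(2.1.3),
  §5.1.2 (5.1.9).

MOTIVATION (cell ns-blowup, zone Z3, case Z3-SR-CERT; recorded for provenance only): this is the
analytic core of the OUTPUT HIGH-PASS LEMMA (E5) of the sheet-ℝ certificate chain
(`HOME/profile/cert/impl1/SHEET-R-PRICE-impl1.md` §1 (E5), `PREREG-SHEET-R-CERT.md` P4): in the
Cayley frame `e_n = (1 + cos θ) sin nθ` the `w`-orthogonal high-pass `Π_T` of `ψ` is
`(2L³)^{1/2}` times the `L²(dθ)` tail `g − S_N g` of `g = ψ/(1 + cos θ)`, so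
`‖Π_T ψ‖_w ≤ (2L³)^{1/2} ‖∂_θ g‖_{L²(dθ)}/(N + 1)` is this theorem with `T = 2π`.  WHAT THIS IS
NOT: nothing about Navier–Stokes; a classical Fourier-series inequality.
-/

noncomputable section

open MeasureTheory Set Complex Real Filter Finset
open scoped Topology BigOperators

namespace Literature.Analysis.Fourier

variable {a b : ℝ}

/-- `x ↦ e_n(x) = fourier n (x : AddCircle T)` is continuous on `ℝ`. [folklore] -/
private theorem continuous_fourier_coe (T : ℝ) (n : ℤ) :
    Continuous fun x : ℝ => fourier n (x : AddCircle T) :=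
  (map_continuous (fourier n)).comp (AddCircle.continuous_mk' T)

/-- A continuous function is square integrable on the window `(a, b]`. [folklore] -/
private theorem memLp_two_Ioc {f : ℝ → ℂ} (hf : Continuous f) (a b : ℝ) :
    MemLp f 2 (volume.restrict (Ioc a b)) := by
  obtain ⟨C, hC⟩ := (isCompact_Icc (a := a) (b := b)).exists_bound_of_continuousOn hf.continuousOn
  have htop : MemLp f ⊤ (volume.restrict (Ioc a b)) := by
    refine memLp_top_of_bound hf.aestronglyMeasurable C ?_
    rw [ae_restrict_iff' measurableSet_Ioc]
    exact Eventually.of_forall fun x hx => hC x (Ioc_subset_Icc_self hx)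
  exact htop.mono_exponent le_top

/-- **Orthonormality of the characters on a window.** For `a < b`, `T = b − a` and integers `m, n`:
`c_n(e_m) = δ_{nm}`, where `e_m(x) = fourier m (x : AddCircle T)` and `c_n = fourierCoeffOn` on
`[a, b]` — the orthogonality relation `∫_0^{2π} φ_k φ̄_l = 2π δ_{kl}` of the Fourier system, transported to
the window `[a, b]`. [cite: CanutoEtAl2006, §2.1.1 eq. (2.1.2)–(2.1.3)] -/
theorem fourierCoeffOn_fourier_coe (hab : a < b) (m n : ℤ) :
    fourierCoeffOn hab (fun x : ℝ => fourier m (x : AddCircle (b - a))) n =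
      if n = m then 1 else 0 := by
  have hT : 0 < b - a := sub_pos.2 hab
  haveI hT' : Fact (0 < b - a) := ⟨hT⟩
  rw [fourierCoeffOn_eq_integral]
  have hint : (∫ x in a..b, fourier (-n) (x : AddCircle (b - a)) • fourier m (x : AddCircle (b - a)))
      = ∫ x in a..b, fourier (-(n - m)) (x : AddCircle (b - a)) := by
    refine intervalIntegral.integral_congr fun x _ => ?_
    simp only [smul_eq_mul]
    rw [← fourier_add]
    congr 1
    ring
  rw [hint]
  split_ifs with hnm
  · subst hnm
    simp only [sub_self, neg_zero, fourier_zero, intervalIntegral.integral_const, Complex.real_smul,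
      Complex.ofReal_sub, mul_one, one_div]
    rw [Complex.ofReal_inv, Complex.ofReal_sub]
    have hba : (b : ℂ) - a ≠ 0 := by
      rw [← Complex.ofReal_sub]
      exact_mod_cast hT.ne'
    field_simp
  · have hk : n - m ≠ 0 := sub_ne_zero.2 hnm
    -- the character of nonzero index integrates to zero over a period (FTC + periodicity)
    have hderiv := fun x : ℝ => has_antideriv_at_fourier_neg hT' hk x
    rw [intervalIntegral.integral_eq_sub_of_hasDerivAt (fun x _ => hderiv x)
      ((continuous_fourier_coe (b - a) (-(n - m))).intervalIntegrable _ _)]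
    have s2 : (b : AddCircle (b - a)) = (a : AddCircle (b - a)) := by
      simpa using AddCircle.coe_add_period (b - a) a
    rw [s2, sub_self, smul_zero]

/-- `e_n(x) • g(x)` is interval integrable for continuous `g`. [folklore] -/
private theorem intervalIntegrable_fourier_smul {g : ℝ → ℂ} (hg : Continuous g) (T : ℝ) (n : ℤ)
    (a b : ℝ) : IntervalIntegrable (fun x : ℝ => fourier n (x : AddCircle T) • g x) volume a b :=
  ((continuous_fourier_coe T n).smul hg).intervalIntegrable a b

/-- Linearity bookkeeping: the Fourier coefficients of `f − ∑_{m ∈ s} c_m e_m` on `[a, b]` are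
`c_n(f) − ∑_{m ∈ s} c_m c_n(e_m)` (`f` continuous, `s` finite). [folklore] -/
private theorem fourierCoeffOn_sub_sum_fourier (hab : a < b) {f : ℝ → ℂ} (hf : Continuous f)
    (s : Finset ℤ) (c : ℤ → ℂ) (n : ℤ) :
    fourierCoeffOn hab (fun x => f x - ∑ m ∈ s, c m * fourier m (x : AddCircle (b - a))) n =
      fourierCoeffOn hab f n -
        ∑ m ∈ s, c m * fourierCoeffOn hab (fun x : ℝ => fourier m (x : AddCircle (b - a))) n := by
  simp only [fourierCoeffOn_eq_integral]
  have hS : Continuous fun x : ℝ => ∑ m ∈ s, c m * fourier m (x : AddCircle (b - a)) :=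
    continuous_finsetSum _ fun m _ => continuous_const.mul (continuous_fourier_coe _ m)
  have h1 : (∫ x in a..b, fourier (-n) (x : AddCircle (b - a)) •
        (f x - ∑ m ∈ s, c m * fourier m (x : AddCircle (b - a)))) =
      (∫ x in a..b, fourier (-n) (x : AddCircle (b - a)) • f x) -
        ∫ x in a..b, fourier (-n) (x : AddCircle (b - a)) •
          ∑ m ∈ s, c m * fourier m (x : AddCircle (b - a)) := by
    rw [← intervalIntegral.integral_sub (intervalIntegrable_fourier_smul hf _ _ _ _)
      (intervalIntegrable_fourier_smul hS _ _ _ _)]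
    refine intervalIntegral.integral_congr fun x _ => ?_
    simp only [smul_sub]
  have hint : ∀ m ∈ s, IntervalIntegrable (fun x : ℝ => c m *
      (fourier (-n) (x : AddCircle (b - a)) • fourier m (x : AddCircle (b - a)))) volume a b :=
    fun m _ => (continuous_const.mul ((continuous_fourier_coe _ (-n)).smul
      (continuous_fourier_coe _ m))).intervalIntegrable _ _
  have h2 : (∫ x in a..b, fourier (-n) (x : AddCircle (b - a)) •
        ∑ m ∈ s, c m * fourier m (x : AddCircle (b - a))) =
      ∑ m ∈ s, c m * ∫ x in a..b, fourier (-n) (x : AddCircle (b - a)) •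
        fourier m (x : AddCircle (b - a)) := by
    calc (∫ x in a..b, fourier (-n) (x : AddCircle (b - a)) •
          ∑ m ∈ s, c m * fourier m (x : AddCircle (b - a)))
        = ∫ x in a..b, ∑ m ∈ s, c m *
            (fourier (-n) (x : AddCircle (b - a)) • fourier m (x : AddCircle (b - a))) := by
          refine intervalIntegral.integral_congr fun x _ => ?_
          simp only [smul_eq_mul, Finset.mul_sum]
          refine Finset.sum_congr rfl fun m _ => ?_
          ring
      _ = ∑ m ∈ s, ∫ x in a..b, c m *
            (fourier (-n) (x : AddCircle (b - a)) • fourier m (x : AddCircle (b - a))) :=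
          intervalIntegral.integral_finsetSum hint
      _ = ∑ m ∈ s, c m * ∫ x in a..b, fourier (-n) (x : AddCircle (b - a)) •
            fourier m (x : AddCircle (b - a)) := by
          refine Finset.sum_congr rfl fun m _ => ?_
          exact intervalIntegral.integral_const_mul _ _
  rw [h1, h2, smul_sub, Finset.smul_sum]
  congr 1
  refine Finset.sum_congr rfl fun m _ => ?_
  rw [Complex.real_smul, Complex.real_smul]
  ring

/-- **`L²` tail of the Fourier partial sum of a periodic `C¹` function** (sharp `m = 1` case of
the spectral truncation estimate; Canuto–Hussaini–Quarteroni–Zang 2006, §5.1.2 eq. (5.1.9)).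
For `a < b`, `T = b − a`, `f : ℝ → ℂ` with continuous derivative `f′` and `f b = f a`, and every
`N : ℕ`:
`∫_a^b ‖f(x) − ∑_{|n| ≤ N} c_n e_n(x)‖² dx ≤ (T/(2π(N+1)))² ∫_a^b ‖f′(x)‖² dx`,
`c_n = fourierCoeffOn f n`, `e_n(x) = fourier n (x : AddCircle T)`.  Printed form:
"`‖u − P_N u‖_{L²(0,2π)} ≤ C N^{-m} ‖u^{(m)}‖_{L²(0,2π)}` … This follows from the Parseval identity";
here `m = 1`, any period, with the sharp constant `T/(2π(N+1))`.
[cite: CanutoEtAl2006, §5.1.2 eq. (5.1.9)] -/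
theorem intervalIntegral_norm_sub_fourierSum_sq_le (hab : a < b) {f f' : ℝ → ℂ}
    (hf : ∀ x, HasDerivAt f (f' x) x) (hf' : Continuous f') (hper : f b = f a) (N : ℕ) :
    ∫ x in a..b, ‖f x - ∑ n ∈ Finset.Icc (-(N : ℤ)) N,
        fourierCoeffOn hab f n * fourier n (x : AddCircle (b - a))‖ ^ 2
      ≤ ((b - a) / (2 * π * (N + 1))) ^ 2 * ∫ x in a..b, ‖f' x‖ ^ 2 := by
  have hT : 0 < b - a := sub_pos.2 hab
  have hfc : Continuous f := continuous_iff_continuousAt.2 fun x => (hf x).continuousAt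
  set S : Finset ℤ := Finset.Icc (-(N : ℤ)) N with hS
  set c : ℤ → ℂ := fun n => fourierCoeffOn hab f n with hc
  set g : ℝ → ℂ := fun x => f x - ∑ n ∈ S, c n * fourier n (x : AddCircle (b - a)) with hg
  have hgc : Continuous g :=
    hfc.sub (continuous_finsetSum _ fun n _ => continuous_const.mul (continuous_fourier_coe _ n))
  -- the Fourier coefficients of `g = f − S_N f`
  have hcoef : ∀ n : ℤ, fourierCoeffOn hab g n = if n ∈ S then 0 else c n := by
    intro n
    rw [hg, fourierCoeffOn_sub_sum_fourier hab hfc S c n]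
    simp only [fourierCoeffOn_fourier_coe hab, mul_ite, mul_one, mul_zero, Finset.sum_ite_eq]
    split_ifs with h <;> simp [hc]
  -- Parseval for `g` and for `f′`
  have Pg := hasSum_sq_fourierCoeffOn hab (memLp_two_Ioc hgc a b)
  have Pf' := hasSum_sq_fourierCoeffOn hab (memLp_two_Ioc hf' a b)
  set K : ℝ := (b - a) / (2 * π * (N + 1)) with hK
  have hK0 : 0 ≤ K := by rw [hK]; positivity
  -- termwise comparison of the two Parseval series
  have hterm : ∀ n : ℤ, ‖fourierCoeffOn hab g n‖ ^ 2 ≤ K ^ 2 * ‖fourierCoeffOn hab f' n‖ ^ 2 := by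
    intro n
    rw [hcoef n]
    split_ifs with hn
    · rw [norm_zero, zero_pow two_ne_zero]
      positivity
    · have hn' : (N : ℤ) + 1 ≤ |n| := by
        rw [hS, Finset.mem_Icc, not_and_or, not_le, not_le] at hn
        rcases hn with h | h
        · rw [abs_of_neg (by omega)]; omega
        · rw [abs_of_pos (by omega)]; omega
      have hn0 : n ≠ 0 := by
        rintro rfl
        simp at hn'
        omega
      have hN : (N : ℝ) + 1 ≤ |(n : ℝ)| := by
        rw [← Int.cast_abs]
        exact_mod_cast hn'
      have hNpos : (0 : ℝ) < (N : ℝ) + 1 := by positivity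
      have hnabs : (0 : ℝ) < |(n : ℝ)| := lt_of_lt_of_le hNpos hN
      -- `c_n = T c_n(f′)/(2π i n)` by parts (boundary term vanishes by periodicity)
      have hcn : c n = (b - a) / (2 * π * I * n) * fourierCoeffOn hab f' n := by
        have h := fourierCoeffOn_of_hasDerivAt hab hn0 (fun x _ => hf x)
          (hf'.intervalIntegrable _ _)
        rw [hper, sub_self, mul_zero, zero_sub] at h
        simp only [hc]
        rw [h]
        have hI : (2 * π * I * n : ℂ) ≠ 0 := by
          have hπ : (π : ℂ) ≠ 0 := by exact_mod_cast Real.pi_ne_zero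
          have hn'' : (n : ℂ) ≠ 0 := by exact_mod_cast hn0
          exact mul_ne_zero (mul_ne_zero (mul_ne_zero two_ne_zero hπ) Complex.I_ne_zero) hn''
        field_simp
      have hnorm : ‖((b - a) / (2 * π * I * n) : ℂ)‖ = (b - a) / (2 * π * |(n : ℝ)|) := by
        rw [norm_div, norm_mul, norm_mul, norm_mul, Complex.norm_I, mul_one, Complex.norm_intCast,
          Complex.norm_two, Complex.norm_real, Real.norm_of_nonneg Real.pi_pos.le]
        rw [← Complex.ofReal_sub, Complex.norm_real, Real.norm_of_nonneg hT.le]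
      have h1 : ‖c n‖ ≤ K * ‖fourierCoeffOn hab f' n‖ := by
        rw [hcn, norm_mul, hnorm]
        gcongr
        rw [hK]
        gcongr
      calc ‖c n‖ ^ 2 ≤ (K * ‖fourierCoeffOn hab f' n‖) ^ 2 := pow_le_pow_left₀ (norm_nonneg _) h1 2
        _ = K ^ 2 * ‖fourierCoeffOn hab f' n‖ ^ 2 := by ring
  have hle := hasSum_le hterm Pg (Pf'.mul_left (K ^ 2))
  rw [smul_eq_mul, smul_eq_mul] at hle
  have hg_int : (∫ x in a..b, ‖g x‖ ^ 2) =
      ∫ x in a..b, ‖f x - ∑ n ∈ S, c n * fourier n (x : AddCircle (b - a))‖ ^ 2 := rfl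
  rw [← hg_int]
  calc (∫ x in a..b, ‖g x‖ ^ 2) = (b - a) * ((b - a)⁻¹ * ∫ x in a..b, ‖g x‖ ^ 2) := by
        field_simp
    _ ≤ (b - a) * (K ^ 2 * ((b - a)⁻¹ * ∫ x in a..b, ‖f' x‖ ^ 2)) := by gcongr
    _ = K ^ 2 * ∫ x in a..b, ‖f' x‖ ^ 2 := by field_simp

end Literature.Analysis.Fourier

end
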